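/-
Copyright (c) 2026. All rights reserved.
Released under Apache 2.0 license as described in the file LICENSE.
Authors: abc-iut cell, seat abc-iut-L4-t10 (gen 4; block W2-B4 model column — the closers: Corollary 4.5 with
ALL its printed clauses at the archimedean models, zero binders).
-/
import Literature.AnabelianGeometry.AbsoluteAnabelian.AbsTopIII.FrobeniusPictureMLFLogTeleFamilyGlue
import Literature.AnabelianGeometry.AbsoluteAnabelian.AbsTopIII.AutHolLogFrobeniusCor45FullModelTMProofs
import Literature.AnabelianGeometry.AbsoluteAnabelian.AbsTopIII.AutHolLogFrobeniusGaloisModelSurfaceGroups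
import Literature.AnabelianGeometry.AbsoluteAnabelian.ArchimedeanHolFieldFunctorGeometricPlaneComplCor45
import Literature.AnabelianGeometry.AbsoluteAnabelian.ArchimedeanHolFieldFunctorGeometricPuncturedEllipticCor45
import Literature.AnabelianGeometry.AbsoluteAnabelian.ArchimedeanHolFieldFunctorGeometricOuterRigidCor45
import HarnessLib

/-!
# [AbsTopIII] Corollary 4.5 with ALL its printed clauses, at the archimedean models — the closers

S. Mochizuki, *Topics in Absolute Anabelian Geometry III*, Cor 4.5 pp.107–110 (kurims manuscript, lit key
`paper:url-5493eb38cbb7`; bib key `MochizukiAbsTopIII2015`).  PROOF-ONLY file (no definition).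

The cell's abstract theorems for the five items and the three compatibility sentences of Cor 3.6 / 4.5
(abc-iut-L4-t5, -w4-d095, -w5-d053, -w6-d023, -w6-d025) are all modulo named inputs that the archimedean
model `archLogFrobeniusData 𝔄` supplies (`id_⋎ = 𝟭`, `arch_telecore_coherent`, `arch_lemma44Property`,
`arch_iotaOverGaloisStmt`); seat abc-iut-L4-t10's model-column files discharged them clause by clause
(p418568, p436692, p438427, p438765, p441892), leaving ONE input: the TELECORE half of the (iii)
compatibility clause, `LogObsCompatTelecoreStmt` — abc-iut-w6-d025's «Cor36-LOGOBS-TELE» chain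
(p441953 … p453695: `logObsCompatTelecoreStmt_of_family'`) instantiated by this seat's
`logObsCompatTelecoreStmt_of_iotaOverGaloisStmt` (`FrobeniusPictureMLFLogTeleFamilyGlue`, p459273: the
glue family of abc-iut-w5-d053 pulled back to `𝒟_An`).  This file feeds that theorem to the models
(`id_⋎ = 𝟭` is fully faithful; `arch_iotaOverGaloisStmt` / `archTM_iotaOverGaloisStmt`):

* `AbsTopIII.cor_4_5_iii_compatTelecore_arch` (`_TM`) — the telecore half of (iii) at `𝒳 = 𝒞^hol_TF`
  (resp. `𝒞^hol_TM`), every `𝔄`, ZERO binders; `cor_4_5_iii_compat_arch` — the whole (iii) compatibility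
  clause, zero binders.
* `AbsTopIII.cor_4_5_full_arch_iff_cor_4_5` — at the archimedean model `Cor_4_5_full ↔ Cor_4_5`: ALL the
  compatibility sentences are theorems there; `cor_4_5_full_arch (X₀) (hE)` — the full corollary from
  `𝕏₀ : EA` and `IsIdRigid EA` alone (Prop 4.2 (i)).
* ZERO-BINDER instances of `Cor_4_5_full`: the geometric carriers `{ℂ, ℂˣ, 𝔻}`
  (`HolRS.cor_4_5_full_geometric_carriers`), ALL finite étale covers of the thrice-punctured sphere and of
  `ℂ ∖ F` for every finite `F` with two points, of every punctured complex torus and every once-punctured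
  elliptic curve (`HolRS.cor_4_5_full_geometric_tripodCovers`, `…_planeComplPairCovers`,
  `…_planeComplCovers`, `…_puncturedTorusCovers`, `…_mapsTo_of_isPuncturedEllipticCurve`), the Galois
  categories `B(G_{ℚ_p})`, `B(F̂_n)` (`n ≥ 2`), `B(Γ̂_{g,r})` (hyperbolic) (`cor_4_5_full_arch_…`); and for a
  general connected `𝕏` with slim `π̂₁` modulo (OUT) «`Aut(𝕏) → Out(π̂₁)` injective» only
  (`…_mapsTo_of_isSlimGroup_of_outer`).
* `AbsTopIII.cor_4_5_full_satisfiable` — NON-VACUITY: some interface datum satisfies `Cor_4_5_full`.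

HONEST SCOPE / CAVEAT (seat abc-iut-L4-t10's self-reported finding F-L4t10g4-1 «COR45-JOINT-WITNESS»):
`Cor_4_5_full` is the CONJUNCTION of the typed clauses, whose telecore witnesses are INDEPENDENT
existentials — (ii)/(v)-sentence-4 are witnessed over abc-iut-L4-t5's `anTelecore` (lifts over `𝒳`), the
(iii) telecore half over abc-iut-w6-d025's `anTelecoreE` (lifts over `ℰ`); print speaks of ONE telecore
`𝔗_LH`.  A joint-witness successor statement is a separate (DEFS-lane) item.  Model-level ≠ node-level
≠ reconstruction; node `AbsTopIII:Cor4.5` is not a counting node.  Refereed pre-IUT anabelian geometry;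
nothing here bears on [IUTchIII] Cor. 3.12 or takes a side; typed ≠ proved.
-/

noncomputable section

namespace Literature.AnabelianGeometry.AbsoluteAnabelian

open _root_.CategoryTheory
open Literature.Topology.CoveringSpaces
open Literature.Geometry.Kaehler Literature.Geometry.Kaehler.ComplexTorus
open Literature.AlgebraicGeometry.Frobenioids (IsSlimGroup BCat)
open Literature.IUT.HodgeTheaters (profiniteCompletion)
open Literature.GroupTheory.CombinatorialGroupTheory (PuncturedSurfaceGroup)

universe u

namespace AbsTopIII

variable (𝔄 : AutHolFieldFunctor.{u})

/-! ### The telecore half of (iii) at the archimedean model — the last input -/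

/-- **[AbsTopIII] Cor 4.5 (iii), second clause, TELECORE half, at the archimedean MODEL `𝒳 = 𝒞^hol_TF`
for EVERY interface datum `𝔄`, ZERO binders**: over a telecore `𝔗_LH` of the printed shape, one family
of homotopies on `𝒟_LH` contains the telecore family and the `𝔖_log` family (abc-iut-w6-d025's closing
theorem of «Cor36-LOGOBS-TELE» fed with `arch_iotaOverGaloisStmt`: `ι_×`, `ι_log` act on arithmetic data
only, "the Galois groups remain undisturbed"). [cite: MochizukiAbsTopIII2015, Corollary 4.5 (iii) p.109] -/
theorem cor_4_5_iii_compatTelecore_arch :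
    (archLogFrobeniusData 𝔄).LogObsCompatTelecoreStmt (archTelecoreData 𝔄) :=
  (archLogFrobeniusData 𝔄).logObsCompatTelecoreStmt_of_iotaOverGaloisStmt (archTelecoreData 𝔄)
    (Functor.FullyFaithful.id _) (arch_iotaOverGaloisStmt 𝔄)

/-- **Cor 4.5 (iii), second clause (cores ∧ telecore halves) at the archimedean model, ZERO binders.**
[cite: MochizukiAbsTopIII2015, Corollary 4.5 (iii) p.109] -/
theorem cor_4_5_iii_compat_arch : Cor_4_5_iii_compat (archLogFrobeniusData 𝔄) (archTelecoreData 𝔄) :=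
  cor_4_5_iii_compat_arch_of_telecore 𝔄 (cor_4_5_iii_compatTelecore_arch 𝔄)

/-! ### The full corollary at the archimedean model -/

/-- **At the archimedean model, `Cor_4_5_full ↔ Cor_4_5`**: every compatibility sentence of (iii)/(v)
is a theorem there, so the full form carries exactly the content of the five typed items.
[cite: MochizukiAbsTopIII2015, Corollary 4.5 pp.107–109] -/
theorem cor_4_5_full_arch_iff_cor_4_5 :
    Cor_4_5_full (archLogFrobeniusData 𝔄) (archTelecoreData 𝔄) ↔
      Cor_4_5 (archLogFrobeniusData 𝔄) (archTelecoreData 𝔄) :=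
  ⟨fun h => h.1,
    fun h => (cor_4_5_full_arch_iff_of_cor_4_5 𝔄 h).mpr (cor_4_5_iii_compatTelecore_arch 𝔄)⟩

/-- **Corollary 4.5 with ALL its printed clauses at the archimedean model `𝒳 = 𝒞^hol_TF`, from exactly
`𝕏₀ : EA` and `IsIdRigid EA`** (Prop 4.2 (i); the inputs of the first two sentences of (v) and of (iv)).
[cite: MochizukiAbsTopIII2015, Corollary 4.5 pp.107–109] -/
theorem cor_4_5_full_arch (X₀ : 𝔄.EA) (hE : IsIdRigid 𝔄.EA) :
    Cor_4_5_full (archLogFrobeniusData 𝔄) (archTelecoreData 𝔄) :=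
  cor_4_5_full_arch_of_logObsCompatTelecore 𝔄 X₀ hE (cor_4_5_iii_compatTelecore_arch 𝔄)

/-- **Cor 4.5 (iii), second clause, TELECORE half, at the archimedean MODEL `𝒳 = 𝒞^hol_TM`** ("where
`T ∈ {TM, TF}`"), every `𝔄`, ZERO binders. [cite: MochizukiAbsTopIII2015, Corollary 4.5 (iii) p.109] -/
theorem cor_4_5_iii_compatTelecore_arch_TM :
    (archLogFrobeniusDataTM 𝔄).LogObsCompatTelecoreStmt (archTelecoreDataTM 𝔄) :=
  (archLogFrobeniusDataTM 𝔄).logObsCompatTelecoreStmt_of_iotaOverGaloisStmt (archTelecoreDataTM 𝔄)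
    (Functor.FullyFaithful.id _) (archTM_iotaOverGaloisStmt 𝔄)

/-- **Corollary 4.5 with ALL its printed clauses at the archimedean model `𝒳 = 𝒞^hol_TM`, from exactly
`𝕏₀ : EA` and `IsIdRigid EA`.** [cite: MochizukiAbsTopIII2015, Corollary 4.5 pp.107–109] -/
theorem cor_4_5_full_arch_TM (X₀ : 𝔄.EA) (hE : IsIdRigid 𝔄.EA) :
    Cor_4_5_full (archLogFrobeniusDataTM 𝔄) (archTelecoreDataTM 𝔄) :=
  cor_4_5_full_arch_TM_of_logObsCompatTelecore 𝔄 X₀ hE (cor_4_5_iii_compatTelecore_arch_TM 𝔄)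

/-! ### Zero-binder instances -/

/-- **`Cor_4_5_full` OUTRIGHT at the Galois-category instance `Π := G_{ℚ_p}`.**
[cite: MochizukiAbsTopIII2015, Corollary 4.5 pp.107–109] -/
theorem cor_4_5_full_arch_absoluteGaloisGroup_padic (p : ℕ) [Fact p.Prime] :
    Cor_4_5_full
      (archLogFrobeniusData (AutHolFieldFunctor.ofGaloisCategory (Field.absoluteGaloisGroup ℚ_[p])))
      (archTelecoreData (AutHolFieldFunctor.ofGaloisCategory (Field.absoluteGaloisGroup ℚ_[p]))) :=
  (cor_4_5_full_arch_absoluteGaloisGroup_padic_iff p).mpr (cor_4_5_iii_compatTelecore_arch _)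

/-- **`Cor_4_5_full` OUTRIGHT at `EA = B(F̂_n)`, `n ≥ 2`** (`F̂₂ = π̂₁` of the thrice-punctured sphere).
[cite: MochizukiAbsTopIII2015, Corollary 4.5 pp.107–109] -/
theorem cor_4_5_full_arch_profiniteCompletion_freeGroup {n : ℕ} (hn : 2 ≤ n) :
    Cor_4_5_full (archLogFrobeniusData (AutHolFieldFunctor.ofGaloisCategory
        (profiniteCompletion (FreeGroup (Fin n)))))
      (archTelecoreData (AutHolFieldFunctor.ofGaloisCategory
        (profiniteCompletion (FreeGroup (Fin n))))) :=
  (cor_4_5_full_arch_profiniteCompletion_freeGroup_iff hn).mpr (cor_4_5_iii_compatTelecore_arch _)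

/-- **`Cor_4_5_full` OUTRIGHT at `EA = B(Γ̂_{g,r})` for every hyperbolic type `(g, r)`.**
[cite: MochizukiAbsTopIII2015, Corollary 4.5 pp.107–109] -/
theorem cor_4_5_full_arch_profiniteCompletion_puncturedSurfaceGroup {g r : ℕ}
    (hgr : PuncturedSurfaceGroup.IsHyperbolicType g r) :
    Cor_4_5_full (archLogFrobeniusData (AutHolFieldFunctor.ofGaloisCategory
        (profiniteCompletion (PuncturedSurfaceGroup g r))))
      (archTelecoreData (AutHolFieldFunctor.ofGaloisCategory
        (profiniteCompletion (PuncturedSurfaceGroup g r)))) :=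
  (cor_4_5_full_arch_profiniteCompletion_puncturedSurfaceGroup_iff hgr).mpr
    (cor_4_5_iii_compatTelecore_arch _)

/-- **NON-VACUITY**: some interface datum satisfies `Cor_4_5_full` — e.g. the one-object datum of
`cor_4_5_arch_hypotheses_satisfiable` (or `B(G_{ℚ_p})`, or the tripod's geometric `EA`).
[cite: MochizukiAbsTopIII2015, Corollary 4.5 pp.107–109] -/
theorem cor_4_5_full_satisfiable :
    ∃ 𝔄 : AutHolFieldFunctor.{0},
      Cor_4_5_full (archLogFrobeniusData 𝔄) (archTelecoreData 𝔄) := by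
  obtain ⟨𝔄, _, _, h⟩ := cor_4_5_arch_hypotheses_satisfiable
  exact ⟨𝔄, (cor_4_5_full_arch_iff_cor_4_5 𝔄).mpr h⟩

end AbsTopIII

namespace HolRS

/-- **`Cor_4_5_full` OUTRIGHT over the geometric carriers `{ℂ, ℂˣ, 𝔻}`.**
[cite: MochizukiAbsTopIII2015, Corollary 4.5 pp.107–109] -/
theorem cor_4_5_full_geometric_carriers :
    AbsTopIII.Cor_4_5_full
      (archLogFrobeniusData (geometricAutHolFieldFunctor
        (fun X : HolRS => X = complexPlane ∨ X = puncturedPlane ∨ X = disc)))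
      (archTelecoreData (geometricAutHolFieldFunctor
        (fun X : HolRS => X = complexPlane ∨ X = puncturedPlane ∨ X = disc))) :=
  cor_4_5_full_geometric_carriers_iff.mpr (AbsTopIII.cor_4_5_iii_compatTelecore_arch _)

/-- **`Cor_4_5_full` OUTRIGHT over the geometric `EA` of ALL finite étale covers of `ℂ ∖ {p, q}`.**
[cite: MochizukiAbsTopIII2015, Corollary 4.5 pp.107–109] -/
theorem cor_4_5_full_geometric_planeComplPairCovers {F : Set ℂ} (hF : F.Finite) (h2 : F.ncard = 2) :
    AbsTopIII.Cor_4_5_full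
      (archLogFrobeniusData (geometricAutHolFieldFunctor (fun Y : HolRS =>
        Nonempty (Y ⟶ planeComplFinite F hF))))
      (archTelecoreData (geometricAutHolFieldFunctor (fun Y : HolRS =>
        Nonempty (Y ⟶ planeComplFinite F hF)))) :=
  (AbsTopIII.cor_4_5_full_arch_iff_of_cor_4_5 _ (cor_4_5_geometric_planeComplPairCovers hF h2)).mpr
    (AbsTopIII.cor_4_5_iii_compatTelecore_arch _)

/-- **`Cor_4_5_full` OUTRIGHT over the geometric `EA` of ALL finite étale covers of the thrice-punctured
sphere `ℙ¹ ∖ {0, 1, ∞}`.** [cite: MochizukiAbsTopIII2015, Corollary 4.5 pp.107–109] -/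
theorem cor_4_5_full_geometric_tripodCovers :
    AbsTopIII.Cor_4_5_full
      (archLogFrobeniusData (geometricAutHolFieldFunctor (fun Y : HolRS =>
        Nonempty (Y ⟶ planeComplFinite ({0, 1} : Set ℂ) (Set.toFinite _)))))
      (archTelecoreData (geometricAutHolFieldFunctor (fun Y : HolRS =>
        Nonempty (Y ⟶ planeComplFinite ({0, 1} : Set ℂ) (Set.toFinite _))))) :=
  (AbsTopIII.cor_4_5_full_arch_iff_of_cor_4_5 _ cor_4_5_geometric_tripodCovers).mpr
    (AbsTopIII.cor_4_5_iii_compatTelecore_arch _)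

/-- **`Cor_4_5_full` OUTRIGHT over the geometric `EA` of ALL finite étale covers of `ℂ ∖ F`, every
finite `F ⊆ ℂ` with two distinct points** (every genus-`0` hyperbolic curve over `ℂ`).
[cite: MochizukiAbsTopIII2015, Corollary 4.5 pp.107–109] -/
theorem cor_4_5_full_geometric_planeComplCovers {F : Set ℂ} (hF : F.Finite) {p₁ p₂ : ℂ}
    (hp₁ : p₁ ∈ F) (hp₂ : p₂ ∈ F) (hp : p₁ ≠ p₂) :
    AbsTopIII.Cor_4_5_full
      (archLogFrobeniusData (geometricAutHolFieldFunctor (fun Y : HolRS =>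
        Nonempty (Y ⟶ planeComplFinite F hF))))
      (archTelecoreData (geometricAutHolFieldFunctor (fun Y : HolRS =>
        Nonempty (Y ⟶ planeComplFinite F hF)))) :=
  (cor_4_5_full_geometric_planeComplCovers_iff hF hp₁ hp₂ hp).mpr
    (AbsTopIII.cor_4_5_iii_compatTelecore_arch _)

/-- **`Cor_4_5_full` OUTRIGHT over the geometric `EA` of ALL finite étale covers of a punctured complex
torus `ℂ/Φ(ℤ²) ∖ {x₀}`.** [cite: MochizukiAbsTopIII2015, Corollary 4.5 pp.107–109] -/
theorem cor_4_5_full_geometric_puncturedTorusCovers (Φ : (Fin 2 → ℝ) ≃L[ℝ] ℂ)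
    (x₀ : ComplexTorus Φ) :
    AbsTopIII.Cor_4_5_full
      (archLogFrobeniusData (geometricAutHolFieldFunctor (fun Y : HolRS =>
        Nonempty (Y ⟶ puncturedTorus Φ x₀))))
      (archTelecoreData (geometricAutHolFieldFunctor (fun Y : HolRS =>
        Nonempty (Y ⟶ puncturedTorus Φ x₀)))) :=
  (cor_4_5_full_geometric_puncturedTorusCovers_iff Φ x₀).mpr
    (AbsTopIII.cor_4_5_iii_compatTelecore_arch _)

/-- **`Cor_4_5_full` OUTRIGHT over the geometric `EA` of ALL finite étale covers of a once-punctured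
elliptic curve `𝕏`** (every genus-`1` hyperbolic curve with one puncture).
[cite: MochizukiAbsTopIII2015, Corollary 4.5 pp.107–109]
[cite: MochizukiAbsTopIII2015, Corollary 2.7 (a) p.58] -/
theorem cor_4_5_full_geometric_mapsTo_of_isPuncturedEllipticCurve (X : HolRS)
    (hX : TorsionPointsDenseUniqueGroupLaw.IsPuncturedEllipticCurve X.carrier) :
    AbsTopIII.Cor_4_5_full
      (archLogFrobeniusData (geometricAutHolFieldFunctor (fun Y : HolRS => Nonempty (Y ⟶ X))))
      (archTelecoreData (geometricAutHolFieldFunctor (fun Y : HolRS => Nonempty (Y ⟶ X)))) :=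
  (cor_4_5_full_geometric_mapsTo_iff_of_isPuncturedEllipticCurve X hX).mpr
    (AbsTopIII.cor_4_5_iii_compatTelecore_arch _)

/-- **`Cor_4_5_full` over `EA^hol_RS(Q_𝕏)` for every connected Riemann surface `𝕏` with slim
`π̂₁(𝕏^top, x₀)`, MODULO print's Lemma 4.3 input (OUT) «`Aut(𝕏) → Out(π̂₁(𝕏^top))` injective» only**
(abc-iut-w5-d144's outer-rigidity junction). [cite: MochizukiAbsTopIII2015, Corollary 4.5 pp.107–109] -/
theorem cor_4_5_full_geometric_mapsTo_of_isSlimGroup_of_outer (X : HolRS) (x₀ : X.carrier)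
    (h : IsSlimGroup (profiniteCompletion (FundamentalGroup X.carrier x₀)))
    (hout : ∀ (σ : X ≅ X) (δ : Path x₀ (σ.hom.toFun x₀))
      (θ : FundamentalGroup X.carrier x₀ →* FundamentalGroup X.carrier x₀),
      (∀ γ : FundamentalGroup X.carrier x₀,
        Path.Homotopic.Quotient.map (FundamentalGroup.toPath (θ γ))
            ⟨σ.hom.toFun, σ.hom.mdifferentiable.continuous⟩ =
          (Path.Homotopic.Quotient.mk δ).symm.trans
            ((FundamentalGroup.toPath γ).trans (Path.Homotopic.Quotient.mk δ))) →
      (∃ n : profiniteCompletion (FundamentalGroup X.carrier x₀),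
        ∀ γ : FundamentalGroup X.carrier x₀,
          Literature.IUT.HodgeTheaters.toCompletion _ (θ γ) =
            n⁻¹ * Literature.IUT.HodgeTheaters.toCompletion _ γ * n) →
      σ.hom = 𝟙 X) :
    AbsTopIII.Cor_4_5_full
      (archLogFrobeniusData (geometricAutHolFieldFunctor (fun Y : HolRS => Nonempty (Y ⟶ X))))
      (archTelecoreData (geometricAutHolFieldFunctor (fun Y : HolRS => Nonempty (Y ⟶ X)))) :=
  (X.cor_4_5_full_geometric_mapsTo_iff_of_isSlimGroup_of_outer x₀ h hout).mpr
    (AbsTopIII.cor_4_5_iii_compatTelecore_arch _)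

/-- `Cor_4_5_full` over `EA^hol_RS(Q_𝕏)` for every connected Riemann surface `𝕏` with slim `π̂₁(𝕏^top)`
satisfying (H1′) (abc-iut-w5-d144's descent inputs). [cite: MochizukiAbsTopIII2015, Corollary 4.5 pp.107–109] -/
theorem cor_4_5_full_geometric_mapsTo_of_twist_of_isSlimGroup (X : HolRS) (x₀ : X.carrier)
    (h : IsSlimGroup (profiniteCompletion (FundamentalGroup X.carrier x₀)))
    (h1' : ∀ σ : X ≅ X, Nonempty (Over.map σ.hom ≅ 𝟭 (Over X)) → σ.hom = 𝟙 X) :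
    AbsTopIII.Cor_4_5_full
      (archLogFrobeniusData (geometricAutHolFieldFunctor (fun Y : HolRS => Nonempty (Y ⟶ X))))
      (archTelecoreData (geometricAutHolFieldFunctor (fun Y : HolRS => Nonempty (Y ⟶ X)))) :=
  (AbsTopIII.cor_4_5_full_arch_iff_of_cor_4_5 _
      (X.cor_4_5_geometric_mapsTo_of_twist_of_isSlimGroup x₀ h h1')).mpr
    (AbsTopIII.cor_4_5_iii_compatTelecore_arch _)

end HolRS

end Literature.AnabelianGeometry.AbsoluteAnabelian
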